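import Summits.QuantumFields.QCD.Theorems.ChiralOneScaleTrajectory.Negative.ShellDepth

/-!
# `ChiralOneScaleTrajectory` (crux stmt-QuantumFields-17512) — negative-side support: one-scale ∧ (iii) force the
# shell to be log-deep and the physical volume to be SUPERLOGARITHMIC

Standing disprover (cdisprove cycle 1), continuation of `Negative/ShellDepth.lean` (common exponent of the one-scale
clause and of clause (iii); vocabulary of `Theorems/MobilityGap/Negative/LowerPin.lean`).

* `volume_lower_bound` — along a regularisation with `β_k → +∞`, if (iii) holds with data `(s, c₀, C₁, p)` and the
  one-scale matrix holds at power `q ≥ max p 1` with the same exponent `s`, then EVENTUALLY IN `k`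
  `(q − p⁺) · log(1/a_k) + log(c₀/2^{p⁺}) ≤ C₁⁺ · (a_k L_k)` (`x⁺ = max x 0`).
  Proof: at the shell point of the torus `S = L_k` the sandwich `rpow_le_of_sandwich` reads
  `(1+|β_k|)^q ≤ 2^{p⁺} e^{C₁⁺ a_k ℓ₀} ℓ₀^{p⁺−q}/c₀`; a shallow shell `a_k ℓ₀ < 1` would bound the right side by
  `2^{p⁺} e^{C₁⁺}/c₀`, impossible once `β_k` is large, and a deep shell has `ℓ₀^{p⁺−q} ≤ a_k^{q−p⁺}`, whence
  `c₀ ≤ 2^{p⁺} e^{C₁⁺ a_k ℓ₀} a_k^{q−p⁺}` with `ℓ₀ ≤ L_k`.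
* `tendsto_volume_div_log` — hence, if the one-scale clause holds at EVERY power `q` with the exponent of (iii)
  (as it does in any witness proving both clauses at one `s`), the physical volume is superlogarithmic:
  `a_k L_k / log(1/a_k) → +∞`.  This is the exact converse of the landed sufficiency
  `OneScaleTrajectoryContent.oneScale_of_upper` (clause (ii) + superlogarithmic volume ⇒ one-scale): modulo the
  decay input, superlogarithmic volume is NECESSARY AND SUFFICIENT for the one-scale clause next to (iii).  For the
  crux it means clause (iv) (sign coherence at the scheme's own side `2L_k+1`) has to be met at physical
  four-volumes `≫ (log 1/a_k)⁴`, never at logarithmic ones; and `tendsto_volume_div_log_of_hasAsymptoticScaling`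
  states it at crux level (`N_f ∈ {2,3}`, two-loop asymptotic scaling).
-/

noncomputable section

namespace Summit.QuantumFields.QCD.Theorems.ChiralOneScaleTrajectory.Negative

open scoped BigOperators Topology
open MeasureTheory Filter Set
open Literature.MathematicalPhysics.QuantumFieldTheory Literature.MathematicalPhysics.QuantumLattice
  Literature.Probability.LatticeModels
open Summit.QuantumFields.QCD.Theorems.MobilityGapNegative

variable {Nf : ℕ}

/-- **Log-deep shell / volume lower bound (common exponent).** See the module docstring. -/
theorem volume_lower_bound (reg : QCDRegularisation Nf) (m : Fin Nf → ℝ)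
    (hβ : Tendsto reg.β atTop atTop) (f : Fin Nf) {s c₀ C₁ p K₀ : ℝ} {q : ℕ} (hq : 1 ≤ q)
    (hqP : max p 0 ≤ q) (hc₀ : 0 < c₀)
    (hL : ∀ᶠ k in atTop, ∀ S : ℕ, reg.L k ≤ S → ∀ (f : Fin Nf) (n : ℕ), n ≤ S →
      c₀ * Real.exp (-(C₁ * (reg.a k * n) + p * Real.log (n + 1))) ≤
        fm Nf (reg.β k) (bare reg m k) S f (Pi.single 0 (n : ℤ)) s)
    (hO : ∀ᶠ k in atTop, ∃ ℓ₀ : ℕ, 1 ≤ ℓ₀ ∧ ℓ₀ ≤ reg.L k ∧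
      (ℓ₀ : ℝ) * reg.a k ≤ K₀ * (1 + |Real.log (reg.a k)|) ∧ ∀ S : ℕ, reg.L k ≤ S →
        ∀ (f : Fin Nf) (v : Site 4), v ∈ box 4 S → ‖v‖ = (ℓ₀ : ℝ) →
          (ℓ₀ : ℝ) ^ q * (1 + |reg.β k|) ^ q * fm Nf (reg.β k) (bare reg m k) S f v s ≤ 1) :
    ∀ᶠ k in atTop, ((q : ℝ) - max p 0) * Real.log (1 / reg.a k) + Real.log (c₀ / 2 ^ max p 0) ≤
      max C₁ 0 * (reg.a k * reg.L k) := by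
  set P : ℝ := max p 0 with hP
  set C : ℝ := max C₁ 0 with hC
  have hP0 : 0 ≤ P := le_max_right _ _
  have hC0 : 0 ≤ C := le_max_right _ _
  have h2P : 0 < (2 : ℝ) ^ P := Real.rpow_pos_of_pos (by norm_num) _
  have ha1 : ∀ᶠ k in atTop, reg.a k ≤ 1 := reg.tendsto_a.eventually (eventually_le_nhds one_pos)
  have hbig : ∀ᶠ k in atTop, (2 : ℝ) ^ P * Real.exp C / c₀ < reg.β k := hβ.eventually_gt_atTop _
  filter_upwards [hL, hO, ha1, hbig] with k hLk ⟨ℓ₀, hℓ1, hℓL, _, hOk⟩ hak hβk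
  have ha := reg.a_pos k
  have hℓ : (1 : ℝ) ≤ ℓ₀ := by exact_mod_cast hℓ1
  have hℓ0 : (0 : ℝ) < ℓ₀ := by linarith
  -- the sandwich at the shell point of the torus `S = L_k`
  have h1 := hLk (reg.L k) le_rfl f ℓ₀ hℓL
  have h2 := hOk (reg.L k) le_rfl f (Pi.single 0 (ℓ₀ : ℤ)) (single_mem_box_of_le hℓL) (norm_single_natCast ℓ₀)
  rw [← Real.rpow_natCast, ← Real.rpow_natCast] at h2
  have hB : (0 : ℝ) ≤ 1 + |reg.β k| := by positivity
  have h3 := rpow_le_of_sandwich hc₀ ha hℓ hB h1 h2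
  have hqP' : P - q ≤ 0 := by linarith
  -- `(1+|β_k|)^q ≥ β_k > 2^P e^C / c₀`
  have h4 : (2 : ℝ) ^ P * Real.exp C / c₀ < (1 + |reg.β k|) ^ (q : ℝ) :=
    calc (2 : ℝ) ^ P * Real.exp C / c₀ < reg.β k := hβk
      _ ≤ 1 + |reg.β k| := by linarith [le_abs_self (reg.β k)]
      _ ≤ (1 + |reg.β k|) ^ (q : ℝ) :=
          Real.self_le_rpow_of_one_le (by linarith [abs_nonneg (reg.β k)]) (by exact_mod_cast hq)
  -- the shell is deep: `a_k ℓ₀ ≥ 1`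
  have hx : 1 ≤ reg.a k * ℓ₀ := by
    by_contra hx
    push Not at hx
    have e1 : Real.exp (C * (reg.a k * ℓ₀)) ≤ Real.exp C := by
      refine Real.exp_le_exp.2 ?_
      calc C * (reg.a k * ℓ₀) ≤ C * 1 := mul_le_mul_of_nonneg_left hx.le hC0
        _ = C := mul_one _
    have e2 : (ℓ₀ : ℝ) ^ (P - q : ℝ) ≤ 1 := Real.rpow_le_one_of_one_le_of_nonpos hℓ hqP'
    have : (1 + |reg.β k|) ^ (q : ℝ) ≤ (2 : ℝ) ^ P * Real.exp C / c₀ := by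
      calc (1 + |reg.β k|) ^ (q : ℝ) ≤ (2 : ℝ) ^ P * Real.exp (C * (reg.a k * ℓ₀)) * (ℓ₀ : ℝ) ^ (P - q : ℝ) / c₀ := h3
        _ ≤ (2 : ℝ) ^ P * Real.exp C * 1 / c₀ := by
            refine div_le_div_of_nonneg_right ?_ hc₀.le
            exact mul_le_mul (mul_le_mul_of_nonneg_left e1 h2P.le) e2 (Real.rpow_nonneg hℓ0.le _)
              (by positivity)
        _ = (2 : ℝ) ^ P * Real.exp C / c₀ := by rw [mul_one]
    linarith
  -- deep shell: `ℓ₀^{P-q} ≤ a_k^{q-P}`, so `c₀ ≤ 2^P e^{C a_k ℓ₀} a_k^{-(P-q)}`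
  have e2 : (ℓ₀ : ℝ) ^ (P - q : ℝ) ≤ reg.a k ^ (-(P - q) : ℝ) := by
    have hinv : (reg.a k)⁻¹ ≤ ℓ₀ := by
      rw [inv_le_iff_one_le_mul₀ ha, mul_comm]; exact hx
    calc (ℓ₀ : ℝ) ^ (P - q : ℝ) ≤ (reg.a k)⁻¹ ^ (P - q : ℝ) :=
          Real.rpow_le_rpow_of_nonpos (inv_pos.2 ha) hinv hqP'
      _ = reg.a k ^ (-(P - q) : ℝ) := by rw [Real.inv_rpow ha.le, ← Real.rpow_neg ha.le]
  have h5 : (1 : ℝ) ≤ (1 + |reg.β k|) ^ (q : ℝ) := Real.one_le_rpow (by linarith [abs_nonneg (reg.β k)]) (by positivity)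
  have h6 : c₀ ≤ (2 : ℝ) ^ P * Real.exp (C * (reg.a k * ℓ₀)) * reg.a k ^ (-(P - q) : ℝ) := by
    have : (1 : ℝ) ≤ (2 : ℝ) ^ P * Real.exp (C * (reg.a k * ℓ₀)) * reg.a k ^ (-(P - q) : ℝ) / c₀ :=
      calc (1 : ℝ) ≤ (1 + |reg.β k|) ^ (q : ℝ) := h5
        _ ≤ (2 : ℝ) ^ P * Real.exp (C * (reg.a k * ℓ₀)) * (ℓ₀ : ℝ) ^ (P - q : ℝ) / c₀ := h3
        _ ≤ (2 : ℝ) ^ P * Real.exp (C * (reg.a k * ℓ₀)) * reg.a k ^ (-(P - q) : ℝ) / c₀ :=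
            div_le_div_of_nonneg_right (mul_le_mul_of_nonneg_left e2 (by positivity)) hc₀.le
    rwa [le_div_iff₀ hc₀, one_mul] at this
  -- take logarithms
  have h7 : Real.log c₀ ≤ P * Real.log 2 + C * (reg.a k * ℓ₀) + (-(P - q)) * Real.log (reg.a k) := by
    have := Real.log_le_log hc₀ h6
    rwa [Real.log_mul (by positivity) (Real.rpow_pos_of_pos ha _).ne', Real.log_mul h2P.ne' (Real.exp_pos _).ne',
      Real.log_rpow (by norm_num), Real.log_exp, Real.log_rpow ha] at this
  have hlog1 : Real.log (1 / reg.a k) = -Real.log (reg.a k) := by rw [one_div, Real.log_inv]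
  have hlog2 : Real.log (c₀ / (2 : ℝ) ^ P) = Real.log c₀ - P * Real.log 2 := by
    rw [Real.log_div hc₀.ne' h2P.ne', Real.log_rpow (by norm_num)]
  have hℓL' : reg.a k * ℓ₀ ≤ reg.a k * reg.L k := mul_le_mul_of_nonneg_left (by exact_mod_cast hℓL) ha.le
  rw [hlog1, hlog2]
  nlinarith [mul_le_mul_of_nonneg_left hℓL' hC0]

/-- `log(1/a_k) → +∞` along every regularisation. -/
theorem tendsto_log_inv_a (reg : QCDRegularisation Nf) : Tendsto (fun k => Real.log (1 / reg.a k)) atTop atTop := by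
  have h1 : Tendsto (fun k => (reg.a k)⁻¹) atTop atTop :=
    tendsto_inv_nhdsGT_zero.comp (tendsto_nhdsWithin_iff.2 ⟨reg.tendsto_a, Eventually.of_forall fun k => reg.a_pos k⟩)
  refine (Real.tendsto_log_atTop.comp h1).congr fun k => ?_
  simp only [Function.comp_apply, one_div]

/-- **Superlogarithmic volume is necessary (common exponent).** If (iii) holds with data `(s, c₀, C₁, p)` and the
one-scale clause holds at EVERY power `q` with the same exponent `s`, along a regularisation with `β_k → +∞`, then
`a_k L_k / log(1/a_k) → +∞`. -/
theorem tendsto_volume_div_log (reg : QCDRegularisation Nf) (m : Fin Nf → ℝ)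
    (hβ : Tendsto reg.β atTop atTop) (f : Fin Nf) {s c₀ C₁ p : ℝ} (hc₀ : 0 < c₀)
    (hL : ∀ᶠ k in atTop, ∀ S : ℕ, reg.L k ≤ S → ∀ (f : Fin Nf) (n : ℕ), n ≤ S →
      c₀ * Real.exp (-(C₁ * (reg.a k * n) + p * Real.log (n + 1))) ≤
        fm Nf (reg.β k) (bare reg m k) S f (Pi.single 0 (n : ℤ)) s)
    (hO : ∀ q : ℕ, ∃ K₀ : ℝ, ∀ᶠ k in atTop, ∃ ℓ₀ : ℕ, 1 ≤ ℓ₀ ∧ ℓ₀ ≤ reg.L k ∧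
      (ℓ₀ : ℝ) * reg.a k ≤ K₀ * (1 + |Real.log (reg.a k)|) ∧ ∀ S : ℕ, reg.L k ≤ S →
        ∀ (f : Fin Nf) (v : Site 4), v ∈ box 4 S → ‖v‖ = (ℓ₀ : ℝ) →
          (ℓ₀ : ℝ) ^ q * (1 + |reg.β k|) ^ q * fm Nf (reg.β k) (bare reg m k) S f v s ≤ 1) :
    Tendsto (fun k => reg.a k * reg.L k / Real.log (1 / reg.a k)) atTop atTop := by
  set P : ℝ := max p 0 with hP
  set C : ℝ := max C₁ 0 with hC
  have hP0 : 0 ≤ P := le_max_right _ _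
  have hC0 : 0 ≤ C := le_max_right _ _
  set c : ℝ := Real.log (c₀ / 2 ^ P) with hc
  rw [tendsto_atTop]
  intro M
  -- choose the power `q ≥ P + C M⁺ + 1`
  obtain ⟨q, hq⟩ := exists_nat_ge (P + C * max M 0 + 1)
  have hq1 : 1 ≤ q := by
    have : (1 : ℝ) ≤ q := by nlinarith [mul_nonneg hC0 (le_max_right M 0)]
    exact_mod_cast this
  have hqP : P ≤ q := by nlinarith [mul_nonneg hC0 (le_max_right M 0)]
  obtain ⟨K₀, hOq⟩ := hO q
  have hvol := volume_lower_bound reg m hβ f hq1 hqP hc₀ hL hOq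
  have hℓ : ∀ᶠ k in atTop, |c| + 1 ≤ Real.log (1 / reg.a k) := (tendsto_log_inv_a reg).eventually_ge_atTop _
  filter_upwards [hvol, hℓ] with k hk hℓk
  have hℓpos : 0 < Real.log (1 / reg.a k) := by linarith [abs_nonneg c]
  -- `(C M⁺) ℓ < C a L`
  have h1 : C * max M 0 * Real.log (1 / reg.a k) < C * (reg.a k * reg.L k) := by
    have e1 : (C * max M 0 + 1) * Real.log (1 / reg.a k) + c ≤ ((q : ℝ) - P) * Real.log (1 / reg.a k) + c := by
      nlinarith
    have e2 : C * max M 0 * Real.log (1 / reg.a k) < (C * max M 0 + 1) * Real.log (1 / reg.a k) + c := by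
      nlinarith [neg_abs_le c]
    linarith
  rcases hC0.lt_or_eq with hCpos | hC0'
  · have h2 : max M 0 * Real.log (1 / reg.a k) < reg.a k * reg.L k := by
      have := h1; nlinarith
    calc M ≤ max M 0 := le_max_left _ _
      _ ≤ reg.a k * reg.L k / Real.log (1 / reg.a k) := by
          rw [le_div_iff₀ hℓpos]; exact h2.le
  · exfalso
    rw [← hC0'] at h1
    simp at h1

/-- **Crux level**: for `N_f ∈ {2,3}` with two-loop asymptotic scaling (a conjunct of the crux), (iii) at exponent
`s` together with the one-scale clause at every power at the same exponent forces `a_k L_k / log(1/a_k) → +∞`. -/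
theorem tendsto_volume_div_log_of_hasAsymptoticScaling {Nf : ℕ} (hNf : Nf = 2 ∨ Nf = 3)
    (reg : QCDRegularisation Nf) (hAS : (reg.scheme 0 0 0).HasAsymptoticScaling) (m : Fin Nf → ℝ)
    {s c₀ C₁ p : ℝ} (hc₀ : 0 < c₀)
    (hL : ∀ᶠ k in atTop, ∀ S : ℕ, reg.L k ≤ S → ∀ (f : Fin Nf) (n : ℕ), n ≤ S →
      c₀ * Real.exp (-(C₁ * (reg.a k * n) + p * Real.log (n + 1))) ≤
        fm Nf (reg.β k) (bare reg m k) S f (Pi.single 0 (n : ℤ)) s)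
    (hO : ∀ q : ℕ, ∃ K₀ : ℝ, ∀ᶠ k in atTop, ∃ ℓ₀ : ℕ, 1 ≤ ℓ₀ ∧ ℓ₀ ≤ reg.L k ∧
      (ℓ₀ : ℝ) * reg.a k ≤ K₀ * (1 + |Real.log (reg.a k)|) ∧ ∀ S : ℕ, reg.L k ≤ S →
        ∀ (f : Fin Nf) (v : Site 4), v ∈ box 4 S → ‖v‖ = (ℓ₀ : ℝ) →
          (ℓ₀ : ℝ) ^ q * (1 + |reg.β k|) ^ q * fm Nf (reg.β k) (bare reg m k) S f v s ≤ 1) :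
    Tendsto (fun k => reg.a k * reg.L k / Real.log (1 / reg.a k)) atTop atTop := by
  have hNf16 : Nf ≤ 16 := by rcases hNf with rfl | rfl <;> norm_num
  have hNf0 : 0 < Nf := by rcases hNf with rfl | rfl <;> norm_num
  exact tendsto_volume_div_log reg m
    (Summit.QuantumFields.QCD.Cruxes.WindowExtinction.ChessboardColdCells.tendsto_beta_atTop_of_hasAsymptoticScaling
      hNf16 reg hAS) ⟨0, hNf0⟩ hc₀ hL hO

end Summit.QuantumFields.QCD.Theorems.ChiralOneScaleTrajectory.Negative

end
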